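import Literature.AlgebraicGeometry.ModuliOfAbelianVarieties.Lan2013.Sec114Pairings
import HarnessLib

/-!
# Lan 2013, §1.1.4 — discharges (`_holds`) for the statement carpet `Sec114Pairings`

Theorem-only companion (squad TS ruling TS-1; cell hodgecm-mathlib, seat TS-t06) of
`Literature/AlgebraicGeometry/ModuliOfAbelianVarieties/Lan2013/Sec114Pairings.lean`: the named facts of §1.1.4 that are
«Mathlib-level exercises» (review of p848497) are proved here, so that users of `(h : Lan2013_…)` can be fed `Lan2013_…_holds`.

* `Lan2013_11413_holds` — Lemma 1.1.4.13 [Lan2013PELCompactifications, p. 20]: the canonical pairing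
  `⟨(x₁,f₁),(x₂,f₂)⟩ = f₂(x₁) − f₁(x₂)` on `M ⊕ M^∨` is alternating, is an `(𝒪_R, ⋆)`-pairing for the `⋆`-twisted action on `M^∨`,
  and is perfect when `M → M^∨∨` is bijective (injectivity: test against `(x, 0)` and `(0, f)`; surjectivity: `φ ↦ (m, −φ∘inl)`
  with `ev(m) = φ∘inr`).
* `Lan2013_1141_holds` — Lemma 1.1.4.1 (p. 16) in its `Diff⁻¹ = 𝒪^∨` form: `dualTensorHom R₀ 𝒪 L₀` is injective for `𝒪`
  finitely generated projective (retract of a finite free `F`; `dualTensorHomEquivOfBasis` for `F`; naturality).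
* `Lan2013_1145_holds` — Lemma 1.1.4.5 (p. 17): in the `Hom_{R₀}(𝒪, N)` picture, `ε`-Hermitian `P` ↔ `ε`-symmetric
  `(𝒪_R, ⋆)`-pairings `B`, `B(x,y) = P(x,y)(1)`, `P(x,y)(c) = B(x, c·y)` (both `∃!` of the typed statement).

* `isNondegenerate_iff_separatingLeft`, `isSelfDual_iff_nondegenerate_and_surjective` — Def. 1.1.4.7's «nondegenerate» IS
  Mathlib's `LinearMap.SeparatingLeft` (review note on p848497), so the Mathlib API applies verbatim.

No definitions, no new facts, no `sorry`; net debt −3.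
-/

open scoped TensorProduct

namespace Literature.AlgebraicGeometry.ModuliOfAbelianVarieties.Lan2013.Sec114PairingsHolds

open Literature.AlgebraicGeometry.ModuliOfAbelianVarieties.Lan2013.Sec11PreliminariesAlgebra
open Literature.AlgebraicGeometry.ModuliOfAbelianVarieties.Lan2013.Sec112Sec113DeterminantsProjectiveModules
open Literature.AlgebraicGeometry.ModuliOfAbelianVarieties.Lan2013.Sec114Pairings

universe u

section

variable {R : Type u} [CommRing R] {M : Type u} [AddCommGroup M] [Module R M]

/-- Unfolding of `canonicalPairing`. [folklore] -/
private theorem canonicalPairing_apply (p q : M × Module.Dual R M) :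
    canonicalPairing R M p q = q.2 p.1 - p.2 q.1 := rfl

end

/-- **Lemma 1.1.4.13 holds** (discharge of `Sec114Pairings.Lan2013_11413`): the canonical pairing on `M ⊕ M^∨` is alternating, is an
`𝒪_R`-pairing for the `⋆`-twisted action `b · (x, f) = (bx, f ∘ b⋆)`, and is self-dual as soon as `M → M^∨∨` is bijective.
[cite: Lan2013PELCompactifications, Lem. 1.1.4.13 (p. 20; 2010 rev. p. 22)] -/
theorem Lan2013_11413_holds : Lan2013_11413.{u} := by
  intro R₀ _ _ _ K₀ _ _ _ A _ _ _ _ _ _ O _ _ R _ _ M _ _ _ _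
  refine ⟨fun p => ?_, fun b b' _ p q => ?_, fun hev => ⟨?_, ?_⟩⟩
  · simp [canonicalPairing_apply]
  · simp [canonicalPairing_apply]
  · refine (injective_iff_map_eq_zero _).2 fun p hp => ?_
    have h2 : p.2 = 0 := by
      ext x
      have hx := LinearMap.congr_fun hp (x, 0)
      simpa [canonicalPairing_apply] using hx
    have h1 : p.1 = 0 := by
      have he : Module.Dual.eval R M p.1 = Module.Dual.eval R M 0 := by
        ext f
        have hf := LinearMap.congr_fun hp (0, f)
        simpa [canonicalPairing_apply, h2] using hf
      exact hev.1 he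
    exact Prod.ext h1 h2
  · intro φ
    obtain ⟨m, hm⟩ := hev.2 (φ ∘ₗ LinearMap.inr R M (Module.Dual R M))
    refine ⟨(m, -(φ ∘ₗ LinearMap.inl R M (Module.Dual R M))), ?_⟩
    ext q
    · have := LinearMap.congr_fun hm (0 : Module.Dual R M)
      simp [canonicalPairing_apply]
    · have hf := LinearMap.congr_fun hm q
      simp only [Module.Dual.eval_apply, LinearMap.coe_comp, Function.comp_apply, LinearMap.inr_apply] at hf
      simp [canonicalPairing_apply, hf, Prod.mk_zero_zero]

/-- **Lemma 1.1.4.1 holds** (discharge of `Sec114Pairings.Lan2013_1141`): for `𝒪` finitely generated projective over `R₀`, the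
canonical map `𝒪^∨ ⊗ L₀ → Hom_{R₀}(𝒪, L₀)` is injective — `𝒪` is a retract of a finite free module `F`, for which
`dualTensorHomEquivOfBasis` is an isomorphism, and `dualTensorHom` is natural in the retraction.
[cite: Lan2013PELCompactifications, Lem. 1.1.4.1 (p. 16; 2010 rev. p. 18)] -/
theorem Lan2013_1141_holds : Lan2013_1141.{u} := by
  intro R₀ _ _ _ K₀ _ _ _ A _ _ _ _ _ O hO hP L₀ _ _
  haveI : Module.Finite R₀ O := Module.Finite.iff_fg.mpr hO.fg
  obtain ⟨n, f, hf⟩ := Module.Finite.exists_fin' R₀ O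
  obtain ⟨i, hi⟩ := (Module.Projective.iff_split_of_projective f hf).mp hP
  rw [injective_iff_map_eq_zero]
  intro x hx
  have key : ∀ z : Module.Dual R₀ O ⊗[R₀] L₀,
      dualTensorHom R₀ (Fin n → R₀) L₀ (f.dualMap.rTensor L₀ z) = dualTensorHom R₀ O L₀ z ∘ₗ f := by
    intro z
    induction z using TensorProduct.induction_on with
    | zero => simp
    | tmul φ l => ext m; simp [dualTensorHom_apply]
    | add a b ha hb => simp [map_add, ha, hb, LinearMap.add_comp]
  have hy : f.dualMap.rTensor L₀ x = 0 := by
    apply (dualTensorHomEquivOfBasis (N := L₀) (Pi.basisFun R₀ (Fin n))).injective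
    rw [map_zero, dualTensorHomEquivOfBasis_apply, key, hx, LinearMap.zero_comp]
  have hx' : x = i.dualMap.rTensor L₀ (f.dualMap.rTensor L₀ x) := by
    rw [← LinearMap.comp_apply, ← LinearMap.rTensor_comp, LinearMap.dualMap_comp_dualMap, hi,
      LinearMap.dualMap_id, LinearMap.rTensor_id, LinearMap.id_apply]
  rw [hx', hy, map_zero]

section ActLemmas

variable {R₀ : Type u} [CommRing R₀] {A : Type u} [Ring A] [Algebra R₀ A] {O : Subalgebra R₀ A}
  {R : Type u} [CommRing R] [Algebra R₀ R] {M : Type u} [AddCommGroup M] [Module R M] [Module (R ⊗[R₀] O) M]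
  [IsScalarTower R (R ⊗[R₀] O) M]

/-- Unfolding of `act`. [folklore] -/
private theorem act_apply (c : O) (y : M) : act R M c y = ((1 : R) ⊗ₜ[R₀] c) • y := rfl

/-- `act` is multiplicative (module axiom `mul_smul`). [folklore] -/
private theorem act_mul (b c : O) (y : M) : act R M c (act R M b y) = act R M (c * b) y := by
  simp only [act_apply, ← mul_smul, Algebra.TensorProduct.tmul_mul_tmul, mul_one]

/-- `act 1 = id`. [folklore] -/
private theorem act_one (y : M) : act R M (1 : O) y = y := by
  rw [act_apply, ← Algebra.TensorProduct.one_def, one_smul]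

/-- `act` is additive in the ring element. [folklore] -/
private theorem act_add (c c' : O) (y : M) : act R M (c + c') y = act R M c y + act R M c' y := by
  simp only [act_apply, TensorProduct.tmul_add, add_smul]

/-- `act (r • c) = algebraMap R₀ R r • act c`. [folklore] -/
private theorem act_smul (r : R₀) (c : O) (y : M) : act R M (r • c) y = algebraMap R₀ R r • act R M c y := by
  simp only [act_apply]
  rw [← algebraMap_smul (R ⊗[R₀] O) (algebraMap R₀ R r), smul_smul, Algebra.TensorProduct.algebraMap_apply,
    Algebra.algebraMap_self, RingHom.id_apply, Algebra.TensorProduct.tmul_mul_tmul, one_mul]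
  congr 1
  rw [mul_one, TensorProduct.tmul_smul, TensorProduct.smul_tmul', Algebra.algebraMap_eq_smul_one]

end ActLemmas

/-- **Lemma 1.1.4.5 holds** (discharge of `Sec114Pairings.Lan2013_1145`): in the `Hom_{R₀}(𝒪, N)` picture of `Diff⁻¹`-valued
pairings, `ε`-Hermitian pairings `P` and `ε`-symmetric `(𝒪_R, ⋆)`-pairings `B` correspond bijectively via `B(x, y) = P(x, y)(1)`
and `P(x, y)(c) = B(x, c y)`. [cite: Lan2013PELCompactifications, Lem. 1.1.4.5 (p. 17; 2010 rev. pp. 19–21)] -/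
theorem Lan2013_1145_holds : Lan2013_1145.{u} := by
  intro R₀ _ _ _ K₀ _ _ _ A _ _ _ _ _ _ O _ _ _ _ R _ _ M _ _ _ _ N _ _ _ _ ε _ _ _
  have hstar1 : ((1 : O) : A) = star ((1 : O) : A) := by simp
  refine ⟨fun P hP => ?_, fun B hε hOB => ?_⟩
  · -- Hermitian ↦ symmetric: B(x, y) = P(x, y)(1)
    refine ⟨LinearMap.mk₂ R (fun x y => P x y 1) (fun x x' y => by simp) (fun r x y => by simp)
        (fun x y y' => by simp) (fun r x y => by simp), ⟨⟨fun x y => ?_, fun b b' hb x y => ?_⟩, fun x y => rfl⟩,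
        fun B' hB' => ?_⟩
    · simpa using hP.1 x y 1 1 hstar1
    · have hb' : ((b : O) : A) = star ((b' : O) : A) := by rw [hb, star_star]
      simp only [LinearMap.mk₂_apply]
      rw [hP.1 (act R M b x) y 1 1 hstar1, hP.2 y x b 1, hP.2 x y b' 1, one_mul, one_mul, hP.1 x y b' b hb']
    · ext x y
      simp [hB'.2 x y]
  · -- symmetric ↦ Hermitian: P(x, y)(c) = B(x, c y)
    let Pc : M → M → (O →ₗ[R₀] N) := fun x y =>
      { toFun := fun c => B x (act R M c y)
        map_add' := fun c c' => by simp [act_add]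
        map_smul' := fun r c => by simp [act_smul, algebraMap_smul] }
    have Pc_apply : ∀ x y (c : O), Pc x y c = B x (act R M c y) := fun _ _ _ => rfl
    let P : M →ₗ[R] M →ₗ[R] (O →ₗ[R₀] N) :=
      LinearMap.mk₂ R Pc (fun x x' y => by ext c; simp [Pc_apply]) (fun r x y => by ext c; simp [Pc_apply])
        (fun x y y' => by ext c; simp [Pc_apply]) (fun r x y => by ext c; simp [Pc_apply])
    have P_apply : ∀ x y (c : O), P x y c = B x (act R M c y) := fun _ _ _ => rfl
    refine ⟨P, ⟨⟨fun x y c c' hc => ?_, fun x y b c => ?_⟩, fun x y => ?_⟩, fun P' hP' => ?_⟩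
    · rw [P_apply, P_apply, hε x, hOB c c' hc y x]
    · rw [P_apply, P_apply, act_mul]
    · rw [P_apply, act_one]
    · obtain ⟨⟨_, hH2⟩, hB⟩ := hP'
      ext x y c
      rw [P_apply, ← hB x (act R M c y), hH2 x y c 1, one_mul]

section Nondegenerate

variable {R : Type*} [CommRing R] {M : Type*} [AddCommGroup M] [Module R M] {N : Type*} [AddCommGroup N] [Module R N]

/-- Def. 1.1.4.7's nondegeneracy (`x ↦ ⟨x, ·⟩` injective) is Mathlib's `LinearMap.SeparatingLeft`.
[cite: Lan2013PELCompactifications, Def. 1.1.4.7 (p. 19; 2010 rev. p. 21)] -/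
theorem isNondegenerate_iff_separatingLeft (B : M →ₗ[R] M →ₗ[R] N) : IsNondegenerate B ↔ B.SeparatingLeft := by
  rw [LinearMap.separatingLeft_iff_ker_eq_bot, LinearMap.ker_eq_bot]
  rfl

/-- Def. 1.1.4.7's self-duality (`x ↦ ⟨x, ·⟩` bijective) = nondegenerate and `x ↦ ⟨x, ·⟩` surjective.
[cite: Lan2013PELCompactifications, Def. 1.1.4.7 (p. 19; 2010 rev. p. 21)] -/
theorem isSelfDual_iff_nondegenerate_and_surjective (B : M →ₗ[R] M →ₗ[R] N) :
    IsSelfDual B ↔ IsNondegenerate B ∧ Function.Surjective B :=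
  Iff.rfl

end Nondegenerate

end Literature.AlgebraicGeometry.ModuliOfAbelianVarieties.Lan2013.Sec114PairingsHolds
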